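/-
Copyright: the b2b-balaban T⁴-continuum CRUX team, row NE7b OWNER lineage `t4-ne7b-p1` (gen 125). Project licence.
-/
import Summits.QuantumFields.BalabanUV.T4Continuum.Spine.NE7b.SupZdPerturbedResponseTorusLimit
import Summits.QuantumFields.BalabanUV.T4Continuum.Spine.NE7b.SupZdPerturbedSolutionTorusSeam
import Summits.QuantumFields.BalabanUV.T4Continuum.Spine.NE7b.SupZdCovarianceTorusLimit
import Summits.QuantumFields.BalabanUV.T4Continuum.Spine.NE7b.SupTorusPerturbedPointwiseDecay

/-!
# THE THERMODYNAMIC LIMIT OF THE PERTURBED FLUCTUATION COVARIANCE: along the tower `3^k`, the torus `H[V∘wm_k] + K(wm·,wm·)` road's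
# fluctuation part of a block source — `u_k − Σ_{y′}(Σ_{y″}(T^{tor}_{K,k})⁻¹(y′,y″)m_k(y″))ψ^k_{y′}` (`u_k` the torus solution of the window
# reading, `m_k` its block means) — read at `σ_kp` CONVERGES, for every `p ∈ ℤ^d`, to the infinite-volume perturbed fluctuation part
# `u(p) − Σ′_{b″}m(b″)Σ′_{b′}N_K(b′,b″)Ψ^K_{b′}(p)` of (221)∕(225) — for ANY `ℤ^d` objects `Ψ^K, N_K` with (234)'s displayed clauses and ANY
# bounded `ℤ^d` solution `u`; with (243) (Hessian) and (244) (response), ALL THREE next-scale objects of the `H + K` column now have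
# thermodynamic limits.  The `H + K` twin of (206): (247) for `u_k → u` and the block means, (244) for the responses, Tannery over `b″`
# under the domination from (173)'s pointwise decay of `u_k` and (166)∕(167) (row NE7b, node U5c; (166)∕(167)∕(173)∕(244)∕(247) BY NAME;
# [folklore])

Cell `pub-balaban`, sub-cell `t4`, spine estimate NE7b (`T4WeightBudget.RelWeightBound`; the cell's OWN estimate — NOT PRINTED in
[Bałaban 1983–89], NOT PROVED).  Crux-route work under `Spine/NE7b/` by the row OWNER (`t4-ne7b-p1` gen 125, file (248)) under FREEZE
(0)'s crux-prover clause; NOTHING of Bałaban's is named as a Lean object, valued or asserted; no `T4Continuum/Support` leaf typed; no `def`,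
no notation; zero `sorry`.  Imports (BY NAME): the OWNER's (244) `…SupZdPerturbedResponseTorusLimit` (`zd_perturbed_response_torus_limit`,
`tendsto_of_exp_close`; through it (243), (166) `perturbed_nextScale_hessian_local`, (167) `perturbed_supNorm_bound`, `torus_kernel_class`),
(247) `…SupZdPerturbedSolutionTorusSeam` (`zd_perturbed_solution_seam_row`), (206) `…SupZdCovarianceTorusLimit` (`coarse_block_of_block_point`),
(173) `…SupTorusPerturbedPointwiseDecay` (`perturbed_pointwise_decay`), SupTorusBlockDistance `isPseudoDist_torus`, `torus_sum_exp_le`,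
(186) `sum_window_reading`, (189) `summable_exp_l1`, Mathlib's `tendsto_tsum_of_dominated_convergence`.

WHY (located).  The third next-scale object of the road is the fluctuation covariance; (206) took its thermodynamic limit for the linear
column.  For `H + K` the same regrouping `Σ_{y″}m_k(y″)R_k(y″)` and window reading apply; termwise `m_k(σb″) → m(b″)` by (247)'s solution
seam on the `(n+1)^d` points of the block (beyond the window radius of `b″`) and `R_k(σb″) → h^K_{b″}(p)` by (244); the domination is
`|m_k(y″)| ≤ C_pM_fe^{−δ_pρ_k(y″,σb₀)}` ((173), the block source read through the window being a profile source about `σb₀`) times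
`|R_k| ≤ c₁C_sK_{δ₁}` ((166), (167)); Tannery.

WHAT IS PROVED ([folklore]): §1 `blockMeans_decay`, `response_bounded`, `window_term_dominated'` (bookkeeping out of the headline's context);
§2 **`zd_perturbed_fluctuation_torus_limit`** (THE END, as displayed above); §3 toy.

HONEST (what this is NOT).  Pointwise convergence on block sources (no rate typed; general sources by superposition); `d ≥ 3`; `K`
symmetric; scalar skeleton ((A3), NC-NE7b-α UNRULED); nothing of the covariant propagators of [B4]–[B6]; nothing of Bałaban's asserted.
BY-NAME EFFECT ON THE WALL: NONE.  NE7b NOT PRINTED ∕ NOT PROVED; spine PROVED 0∕9; rung (B)+1 — the programme's measures remain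
FINITE-torus statements, whose next-scale Hessian, response AND covariance of the perturbed column converge to the infinite-volume ones;
NOT the mass gap, NOT Clay.  HONEST DEPENDENCY: continuum YM on T⁴ ⇐ BetaPertH ∧ nine spine estimates (0∕9 proved); BetaPertH ⇐ (D1) ∧
(D4) ∧ CAP+tail; G-an2-4 gates asym, D1 and NE2∕3∕4.
-/

set_option autoImplicit false

noncomputable section

namespace Summit.QuantumFields.BalabanUV.T4Continuum.NE7b.SupZdPerturbedCovarianceTorusLimit

open Real Filter Topology
open Literature.MathematicalPhysics.QuantumFieldTheory.Balaban1983to89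
open B6QGQLower276 (X e blk B chart mem_B sum_B sum_B_const blk_chart)
open Beta (Site siteOf windowMap siteOf_windowMap windowMap_siteOf)
open SupTorusBlockDistance (isPseudoDist_torus torus_sum_exp_le)
open SupTorusPerturbedCoarseFloor (perturbed_nextScale_hessian_local)
open SupTorusPerturbedSupNorm (perturbed_supNorm_bound)
open SupTorusPerturbedPointwiseDecay (perturbed_pointwise_decay)
open SupZdPropagatorLimit (torusNorm_le_l1 inWindow_of_le)
open SupZdCoarseOperator (sum_window_reading)
open SupZdExponentialSums (summable_exp_l1)
open SupZdCoarseTorusSeam (torusNorm_eq_l1)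
open SupZdPerturbedColumn (K_pos)
open SupZdCovarianceTorusLimit (coarse_block_of_block_point)
open SupZdPerturbedSolutionTorusSeam (zd_perturbed_solution_seam_row)
open SupZdPerturbedHessianTorusLimit (torus_kernel_class)
open SupZdPerturbedResponseTorusLimit (zd_perturbed_response_torus_limit tendsto_of_exp_close)

variable {d : ℕ}

/-! ## §1. Bookkeeping lemmas -/

/-- **BLOCK MEANS INHERIT POINTWISE DECAY**: if `e^{δρ(σ(blk n (wm x)), y₀)}|v x| ≤ C` at every fine site, the block mean over the block of
`wm y″` is `≤ Ce^{−δρ(y″, y₀)}` ((206) §1: every fine point of that block has coarse block `y″`). [folklore] -/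
theorem blockMeans_decay (n k : ℕ) {C δ : ℝ} (v : Site d ((n + 1) * 3 ^ k) → ℝ) (y₀ : Site d (3 ^ k))
    (hv : ∀ x, exp (δ * ∑ i, ((((siteOf d (3 ^ k) (blk n (windowMap d ((n + 1) * 3 ^ k) x))) i - y₀ i).valMinAbs.natAbs : ℕ) : ℝ))
      * |v x| ≤ C) (y'' : Site d (3 ^ k)) :
    |(((n : ℝ) + 1) ^ d)⁻¹ * ∑ z'' : Fin d → Fin (n + 1), v (siteOf d ((n + 1) * 3 ^ k) (chart n (windowMap d (3 ^ k) y'') z''))|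
      ≤ C * exp (-(δ * ∑ i, (((y'' i - y₀ i).valMinAbs.natAbs : ℕ) : ℝ))) := by
  have hvol : (0 : ℝ) < ((n : ℝ) + 1) ^ d := by positivity
  rw [abs_mul, abs_inv, abs_of_pos hvol, inv_mul_le_iff₀ hvol, ← sum_B (windowMap d (3 ^ k) y'') (fun q => v (siteOf d ((n + 1) * 3 ^ k) q))]
  calc |∑ q ∈ B n (windowMap d (3 ^ k) y''), v (siteOf d ((n + 1) * 3 ^ k) q)|
      ≤ ∑ q ∈ B n (windowMap d (3 ^ k) y''), |v (siteOf d ((n + 1) * 3 ^ k) q)| := Finset.abs_sum_le_sum_abs _ _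
    _ ≤ ∑ _q ∈ B n (windowMap d (3 ^ k) y''), C * exp (-(δ * ∑ i, (((y'' i - y₀ i).valMinAbs.natAbs : ℕ) : ℝ))) :=
        Finset.sum_le_sum fun q hq => by
          have h := hv (siteOf d ((n + 1) * 3 ^ k) q)
          rw [coarse_block_of_block_point n k y'' q hq] at h
          have hE := exp_pos (δ * ∑ i, (((y'' i - y₀ i).valMinAbs.natAbs : ℕ) : ℝ))
          rw [exp_neg, ← div_eq_mul_inv, le_div_iff₀ hE, mul_comm]; exact h
    _ = _ := sum_B_const _ _

/-- **THE TORUS RESPONSES ARE BOUNDED**: `|Tinv(y′,y″)| ≤ c₁e^{−δ₁ρ(y′,y″)}`, `|ψ_{y′}| ≤ B_u` ⟹ `|Σ_{y′}Tinv(y′,y″)ψ_{y′}(x)| ≤ c₁B_uK_{δ₁}`. [folklore] -/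
theorem response_bounded (n k : ℕ) {c₁ δ₁ Bu : ℝ} (hc₁ : 0 ≤ c₁) (hδ₁ : 0 < δ₁) (hBu : 0 ≤ Bu)
    (Tinv : Site d (3 ^ k) → Site d (3 ^ k) → ℝ) (ψ : Site d (3 ^ k) → Site d ((n + 1) * 3 ^ k) → ℝ)
    (hTB : ∀ y y', |Tinv y y'| ≤ c₁ * exp (-(δ₁ * ∑ i, (((y i - y' i).valMinAbs.natAbs : ℕ) : ℝ))))
    (hψB : ∀ y' x, |ψ y' x| ≤ Bu) (y'' : Site d (3 ^ k)) (x : Site d ((n + 1) * 3 ^ k)) :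
    |∑ y' : Site d (3 ^ k), Tinv y' y'' * ψ y' x| ≤ c₁ * Bu * (2 * (1 - exp (-δ₁))⁻¹) ^ d := by
  calc |∑ y' : Site d (3 ^ k), Tinv y' y'' * ψ y' x| ≤ ∑ y' : Site d (3 ^ k), |Tinv y' y'' * ψ y' x| := Finset.abs_sum_le_sum_abs _ _
    _ ≤ ∑ y' : Site d (3 ^ k), c₁ * exp (-(δ₁ * ∑ i, (((y'' i - y' i).valMinAbs.natAbs : ℕ) : ℝ))) * Bu :=
        Finset.sum_le_sum fun y' _ => by
          rw [abs_mul]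
          have e1 := hTB y' y''
          rw [(isPseudoDist_torus (d := d) (3 ^ k)).symm y' y''] at e1
          exact mul_le_mul e1 (hψB y' x) (abs_nonneg _) (by positivity)
    _ = c₁ * Bu * ∑ y' : Site d (3 ^ k), exp (-(δ₁ * ∑ i, (((y'' i - y' i).valMinAbs.natAbs : ℕ) : ℝ))) := by
        rw [Finset.mul_sum]; exact Finset.sum_congr rfl fun y' _ => by ring
    _ ≤ c₁ * Bu * (2 * (1 - exp (-δ₁))⁻¹) ^ d := mul_le_mul_of_nonneg_left (torus_sum_exp_le (3 ^ k) hδ₁ y'') (by positivity)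

/-- **DOMINATION OF ONE WINDOW TERM `m_k(σb″)R_k(σb″)`**: `|m(y″)| ≤ C_me^{−δ_pρ(y″,σb₀)}`, `|R(y″)| ≤ C_R` ⟹ the window-supported term is
`≤ C_me^{δ_p|b₀|₁}C_R·e^{−δ_p|b″|₁}`. [folklore] -/
theorem window_term_dominated' (k : ℕ) {Cm δp CR : ℝ} (hCm : 0 ≤ Cm) (hδp : 0 ≤ δp) (hCR : 0 ≤ CR) (m R : Site d (3 ^ k) → ℝ) (b₀ : X d)
    (hm : ∀ y'', |m y''| ≤ Cm * exp (-(δp * ∑ i, (((y'' i - (siteOf d (3 ^ k) b₀) i).valMinAbs.natAbs : ℕ) : ℝ))))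
    (hR : ∀ y'', |R y''| ≤ CR) (b'' : X d) :
    ‖(if windowMap d (3 ^ k) (siteOf d (3 ^ k) b'') = b'' then m (siteOf d (3 ^ k) b'') * R (siteOf d (3 ^ k) b'') else 0)‖
      ≤ Cm * exp (δp * ∑ i, (((b₀ i).natAbs : ℕ) : ℝ)) * CR * exp (-(δp * ∑ i, ((((0 : X d) i - b'' i).natAbs : ℕ) : ℝ))) := by
  rw [Real.norm_eq_abs]
  split_ifs with hwin
  · rw [abs_mul]
    have e1 := hm (siteOf d (3 ^ k) b'')
    have e2 := hR (siteOf d (3 ^ k) b'')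
    have htri := (isPseudoDist_torus (d := d) (3 ^ k)).triangle (siteOf d (3 ^ k) b'') (siteOf d (3 ^ k) b₀) 0
    have hN0 : ∀ y : Site d (3 ^ k), ∑ i, (((y i - (0 : Site d (3 ^ k)) i).valMinAbs.natAbs : ℕ) : ℝ)
        = ∑ i, ((((y i).valMinAbs).natAbs : ℕ) : ℝ) := fun y => Finset.sum_congr rfl fun i _ => by simp
    rw [hN0, hN0, torusNorm_eq_l1 k (siteOf d (3 ^ k) b''), hwin] at htri
    have e3 := torusNorm_le_l1 (d := d) (3 ^ k) b₀
    have hb0 : ∑ i, ((((0 : X d) i - b'' i).natAbs : ℕ) : ℝ) = ∑ i, (((b'' i).natAbs : ℕ) : ℝ) :=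
      Finset.sum_congr rfl fun i _ => by simp
    rw [hb0]
    have e4 : Cm * exp (-(δp * ∑ i, ((((siteOf d (3 ^ k) b'') i - (siteOf d (3 ^ k) b₀) i).valMinAbs.natAbs : ℕ) : ℝ)))
        ≤ Cm * exp (δp * ∑ i, (((b₀ i).natAbs : ℕ) : ℝ)) * exp (-(δp * ∑ i, (((b'' i).natAbs : ℕ) : ℝ))) := by
      rw [mul_assoc Cm, ← exp_add]
      exact mul_le_mul_of_nonneg_left (exp_le_exp.2 (by nlinarith)) hCm
    calc |m (siteOf d (3 ^ k) b'')| * |R (siteOf d (3 ^ k) b'')|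
        ≤ (Cm * exp (δp * ∑ i, (((b₀ i).natAbs : ℕ) : ℝ)) * exp (-(δp * ∑ i, (((b'' i).natAbs : ℕ) : ℝ)))) * CR :=
          mul_le_mul (e1.trans e4) e2 (abs_nonneg _) (by positivity)
      _ = _ := by ring
  · rw [abs_zero]; positivity

/-! ## §2. THE END: the torus perturbed fluctuation parts converge to the infinite-volume one -/

/-- **HEADLINE — THE THERMODYNAMIC LIMIT OF THE PERTURBED FLUCTUATION COVARIANCE ON A BLOCK SOURCE.**  With the constants and data of
(244) (`γ > 1`; `ε ≤ ε₀`, `μ` under the smallness conditions; symmetric `K`; ANY `Ψ^K, N_K` with (234)'s displayed clauses; ANY torus column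
family `ψ^k`), a source `f` supported in the block `b₀` with `|f| ≤ M_f`, ANY bounded `ℤ^d` solution `u` of `(H_V + K)u = f` and ANY torus
solutions `u_k` of the window readings: at every `p ∈ ℤ^d` the torus fluctuation part `u_k(σ_kp) − Σ_{y′}(Σ_{y″}(T^{tor}_{K,k})⁻¹(y′,y″)m_k(y″))
ψ^k_{y′}(σ_kp)` CONVERGES to `u(p) − Σ′_{b″}m(b″)Σ′_{b′}N_K(b′,b″)Ψ^K_{b′}(p)`. [folklore] -/
theorem zd_perturbed_fluctuation_torus_limit (hd : 3 ≤ d) (a : ℝ) (ha : 0 < a) {lam Lam γ : ℝ} (hlam : lam < min 2 a) (hLam : 0 ≤ Lam)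
    (hγ : 1 < γ) :
    ∃ C₀ CP δ₀ ε₀ : ℝ, 0 < C₀ ∧ 0 < CP ∧ 0 < δ₀ ∧ 0 < ε₀ ∧
    ∀ (ε μ : ℝ), 0 ≤ ε → ε ≤ ε₀ → 0 < μ → μ < δ₀ → μ < γ →
      ε * (2 * (1 - exp (-γ))⁻¹) ^ d * C₀ ≤ 1 / 2 →
      (CP * (2 * (1 - exp (-(δ₀ - μ)))⁻¹) ^ d) * (ε * exp (μ * d) * (2 * (1 - exp (-(γ - μ)))⁻¹) ^ d) ≤ 1 / 2 →
      ε * (2 * (1 - exp (-(γ - 1)))⁻¹) ^ d ≤ (min 2 a - lam) / 4 →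
    ∀ (γz Cz CΨ CN ν : ℝ), 0 < γz → 0 < Cz → 0 ≤ CΨ → 0 ≤ CN → 0 < ν →
    ∀ (n : ℕ) (V : X d → ℝ), (∀ p, -lam ≤ V p) → (∀ p, V p ≤ Lam) →
    ∀ (K : X d → X d → ℝ), (∀ p q, |K p q| ≤ ε * exp (-(γ * ∑ i, (((p i - q i).natAbs : ℕ) : ℝ)))) → (∀ p q, K p q = K q p) →
    ∀ (ΨK N : X d → X d → ℝ),
      (∀ c p, ((n : ℝ) + 1) ^ 2 * ∑ μ', (2 * ΨK c p - ΨK c (p + e μ') - ΨK c (p - e μ'))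
        + a / ((n : ℝ) + 1) ^ d * ∑ q ∈ B n (blk n p), ΨK c q + V p * ΨK c p + ∑' q : X d, K p q * ΨK c q
          = if blk n p = c then 1 else 0) →
      (∀ c p, |ΨK c p| ≤ CΨ) →
      (∀ b c, (((n : ℝ) + 1) ^ d)⁻¹ * ∑ q ∈ B n b, ΨK c q = (((n : ℝ) + 1) ^ d)⁻¹ * ∑ q ∈ B n c, ΨK b q) →
      (∀ (S : Finset (X d)) (g : X d → ℝ), (∀ b, b ∉ S → g b = 0) →
        γz * ∑ b ∈ S, g b ^ 2 ≤ ∑ b ∈ S, g b * ∑ c ∈ S, ((((n : ℝ) + 1) ^ d)⁻¹ * ∑ q ∈ B n b, ΨK c q) * g c) →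
      (∀ b c, |(((n : ℝ) + 1) ^ d)⁻¹ * ∑ q ∈ B n b, ΨK c q| ≤ Cz * exp (-(μ * ∑ i, (((b i - c i).natAbs : ℕ) : ℝ)))) →
      (∀ b c, |N b c| ≤ CN * exp (-(ν * ∑ i, (((b i - c i).natAbs : ℕ) : ℝ)))) →
      (∀ b c, ∑' b' : X d, ((((n : ℝ) + 1) ^ d)⁻¹ * ∑ q ∈ B n b, ΨK b' q) * N b' c = if b = c then 1 else 0) →
    ∀ (ψ : (k : ℕ) → Site d (3 ^ k) → Site d ((n + 1) * 3 ^ k) → ℝ),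
      (∀ (k : ℕ) (y' : Site d (3 ^ k)) (x : Site d ((n + 1) * 3 ^ k)),
        ((n : ℝ) + 1) ^ 2 * ∑ μ', (2 * ψ k y' x - ψ k y' (x + siteOf d ((n + 1) * 3 ^ k) (e μ'))
          - ψ k y' (x - siteOf d ((n + 1) * 3 ^ k) (e μ')))
        + a / ((n : ℝ) + 1) ^ d * ∑ q ∈ B n (blk n (windowMap d ((n + 1) * 3 ^ k) x)), ψ k y' (siteOf d ((n + 1) * 3 ^ k) q)
        + V (windowMap d ((n + 1) * 3 ^ k) x) * ψ k y' x
        + ∑ z, K (windowMap d ((n + 1) * 3 ^ k) x) (windowMap d ((n + 1) * 3 ^ k) z) * ψ k y' z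
        = if siteOf d (3 ^ k) (blk n (windowMap d ((n + 1) * 3 ^ k) x)) = y' then 1 else 0) →
    ∀ (b₀ : X d) (Mf : ℝ) (f : X d → ℝ), (∀ p, blk n p ≠ b₀ → f p = 0) → (∀ p, |f p| ≤ Mf) →
    ∀ (u : X d → ℝ) (Cu : ℝ), (∀ p, |u p| ≤ Cu) →
      (∀ p, ((n : ℝ) + 1) ^ 2 * ∑ μ', (2 * u p - u (p + e μ') - u (p - e μ'))
        + a / ((n : ℝ) + 1) ^ d * ∑ q ∈ B n (blk n p), u q + V p * u p + ∑' q : X d, K p q * u q = f p) →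
    ∀ (useq : (k : ℕ) → Site d ((n + 1) * 3 ^ k) → ℝ),
      (∀ (k : ℕ) (x : Site d ((n + 1) * 3 ^ k)),
        ((n : ℝ) + 1) ^ 2 * ∑ μ', (2 * useq k x - useq k (x + siteOf d ((n + 1) * 3 ^ k) (e μ'))
          - useq k (x - siteOf d ((n + 1) * 3 ^ k) (e μ')))
        + a / ((n : ℝ) + 1) ^ d * ∑ q ∈ B n (blk n (windowMap d ((n + 1) * 3 ^ k) x)), useq k (siteOf d ((n + 1) * 3 ^ k) q)
        + V (windowMap d ((n + 1) * 3 ^ k) x) * useq k x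
        + ∑ z, K (windowMap d ((n + 1) * 3 ^ k) x) (windowMap d ((n + 1) * 3 ^ k) z) * useq k z
        = f (windowMap d ((n + 1) * 3 ^ k) x)) →
    ∀ p : X d,
      Tendsto (fun k : ℕ => useq k (siteOf d ((n + 1) * 3 ^ k) p) - ∑ y' : Site d (3 ^ k), (∑ y'' : Site d (3 ^ k),
          (Matrix.of fun y y' : Site d (3 ^ k) => (((n : ℝ) + 1) ^ d)⁻¹ * ∑ z : Fin d → Fin (n + 1),
            ψ k y' (siteOf d ((n + 1) * 3 ^ k) (chart n (windowMap d (3 ^ k) y) z)))⁻¹ y' y''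
          * ((((n : ℝ) + 1) ^ d)⁻¹ * ∑ z'' : Fin d → Fin (n + 1), useq k (siteOf d ((n + 1) * 3 ^ k) (chart n (windowMap d (3 ^ k) y'') z''))))
          * ψ k y' (siteOf d ((n + 1) * 3 ^ k) p)) atTop
        (𝓝 (u p - ∑' b'' : X d, ((((n : ℝ) + 1) ^ d)⁻¹ * ∑ q ∈ B n b'', u q) * ∑' b' : X d, N b' b'' * ΨK b' p)) := by
  classical
  have hγ0 : 0 < γ := by linarith
  have hm0 : 0 < min 2 a - lam := by linarith
  obtain ⟨C₀, CP, δ₀, ε₀, hC₀, hCP, hδ₀, hε₀, H244⟩ := zd_perturbed_response_torus_limit (d := d) hd a ha hlam hLam hγ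
  obtain ⟨C₀', CP', δ₀', hC₀', hCP', hδ₀', H247⟩ := zd_perturbed_solution_seam_row (d := d) hd a ha hlam hLam
  obtain ⟨ε₁, Csup, hε₁, hCsup, H167⟩ := perturbed_supNorm_bound (d := d) hd a ha hlam hLam hγ0
  refine ⟨max C₀ C₀', max CP CP', min δ₀ δ₀', min ε₀ ε₁, lt_max_of_lt_left hC₀, lt_max_of_lt_left hCP, lt_min hδ₀ hδ₀',
    lt_min hε₀ hε₁, ?_⟩
  intro ε μ hε hεε hμ hμδ hμγ hs1 hs2 hεs γz Cz CΨ CN ν hγz hCz hCΨ hCN hν n V hV hV' K hK hKs ΨK N hA3 hA4 hD1 hE1 hE0 hC1 hC2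
    ψ hψ b₀ Mf f hf0 hfM u Cu huB hu useq husol p
  have hMf : 0 ≤ Mf := (abs_nonneg _).trans (hfM 0)
  -- the smallness conditions at each triple (as in (244))
  have hKγ : 0 < (2 * (1 - exp (-γ))⁻¹) ^ d := K_pos (d := d) hγ0
  have hsm : ∀ (C δ : ℝ), 0 < C → C ≤ max CP CP' → min δ₀ δ₀' ≤ δ → μ < δ →
      (C * (2 * (1 - exp (-(δ - μ)))⁻¹) ^ d) * (ε * exp (μ * d) * (2 * (1 - exp (-(γ - μ)))⁻¹) ^ d) ≤ 1 / 2 := by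
    intro C δ hC hCle hδle hμδ'
    have hKδ : (2 * (1 - exp (-(δ - μ)))⁻¹) ^ d ≤ (2 * (1 - exp (-(min δ₀ δ₀' - μ)))⁻¹) ^ d :=
      SupTorusPerturbedResponse.kernelSum_anti (d := d) (by linarith) (by linarith)
    have hKγμ : 0 < (2 * (1 - exp (-(γ - μ)))⁻¹) ^ d := K_pos (d := d) (sub_pos.2 hμγ)
    have h0 : 0 ≤ ε * exp (μ * d) * (2 * (1 - exp (-(γ - μ)))⁻¹) ^ d := by positivity
    calc (C * (2 * (1 - exp (-(δ - μ)))⁻¹) ^ d) * (ε * exp (μ * d) * (2 * (1 - exp (-(γ - μ)))⁻¹) ^ d)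
        ≤ (max CP CP' * (2 * (1 - exp (-(min δ₀ δ₀' - μ)))⁻¹) ^ d) * (ε * exp (μ * d) * (2 * (1 - exp (-(γ - μ)))⁻¹) ^ d) :=
          mul_le_mul_of_nonneg_right (mul_le_mul hCle hKδ (K_pos (d := d) (by linarith)).le (hC.le.trans hCle)) h0
      _ ≤ 1 / 2 := hs2
  have hs1a : ε * (2 * (1 - exp (-γ))⁻¹) ^ d * C₀ ≤ 1 / 2 :=
    (mul_le_mul_of_nonneg_left (le_max_left _ _) (by positivity)).trans hs1
  have hs1b : ε * (2 * (1 - exp (-γ))⁻¹) ^ d * C₀' ≤ 1 / 2 :=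
    (mul_le_mul_of_nonneg_left (le_max_right _ _) (by positivity)).trans hs1
  have hs2a := hsm CP δ₀ hCP (le_max_left _ _) (min_le_left _ _) (lt_of_lt_of_le hμδ (min_le_left _ _))
  have hs2b := hsm CP' δ₀' hCP' (le_max_right _ _) (min_le_right _ _) (lt_of_lt_of_le hμδ (min_le_right _ _))
  have hμδ₀ : μ < δ₀ := lt_of_lt_of_le hμδ (min_le_left _ _)
  have hμδ₀' : μ < δ₀' := lt_of_lt_of_le hμδ (min_le_right _ _)
  have hεε₀ : ε ≤ ε₀ := hεε.trans (min_le_left _ _)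
  have hεε₁ : ε ≤ ε₁ := hεε.trans (min_le_right _ _)
  -- the torus letters
  obtain ⟨ct, δt, hct, hδt, H166⟩ := perturbed_nextScale_hessian_local (d := d) a ha hm0 hLam hε hγ hεs
  obtain ⟨Cp, δp, hCp, hδp, H173⟩ := perturbed_pointwise_decay (d := d) hd a ha hlam hLam one_pos hε hγ hεs
  have hKt : ∀ (k : ℕ) (x z : Site d ((n + 1) * 3 ^ k)), |K (windowMap d ((n + 1) * 3 ^ k) x) (windowMap d ((n + 1) * 3 ^ k) z)|
      ≤ ε * exp (-(γ * ∑ i, (((x i - z i).valMinAbs.natAbs : ℕ) : ℝ))) := fun k x z => torus_kernel_class _ hγ0.le K hK x z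
  have hKt₁ : ∀ (k : ℕ) (x z : Site d ((n + 1) * 3 ^ k)), |K (windowMap d ((n + 1) * 3 ^ k) x) (windowMap d ((n + 1) * 3 ^ k) z)|
      ≤ ε₁ * exp (-(γ * ∑ i, (((x i - z i).valMinAbs.natAbs : ℕ) : ℝ))) := fun k x z =>
    (hKt k x z).trans (mul_le_mul_of_nonneg_right hεε₁ (exp_pos _).le)
  have hKts : ∀ (k : ℕ) (x z : Site d ((n + 1) * 3 ^ k)), K (windowMap d ((n + 1) * 3 ^ k) x) (windowMap d ((n + 1) * 3 ^ k) z)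
      = K (windowMap d ((n + 1) * 3 ^ k) z) (windowMap d ((n + 1) * 3 ^ k) x) := fun k x z => hKs _ _
  -- abbreviations
  obtain ⟨Tinv, hTinv⟩ : ∃ Tinv : (k : ℕ) → Site d (3 ^ k) → Site d (3 ^ k) → ℝ, ∀ k y y', Tinv k y y' =
      (Matrix.of fun y y' : Site d (3 ^ k) => (((n : ℝ) + 1) ^ d)⁻¹ * ∑ z : Fin d → Fin (n + 1),
        ψ k y' (siteOf d ((n + 1) * 3 ^ k) (chart n (windowMap d (3 ^ k) y) z)))⁻¹ y y' := ⟨_, fun _ _ _ => rfl⟩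
  obtain ⟨mk, hmk⟩ : ∃ mk : (k : ℕ) → Site d (3 ^ k) → ℝ, ∀ k y'', mk k y'' = (((n : ℝ) + 1) ^ d)⁻¹
      * ∑ z'' : Fin d → Fin (n + 1), useq k (siteOf d ((n + 1) * 3 ^ k) (chart n (windowMap d (3 ^ k) y'') z'')) := ⟨_, fun _ _ => rfl⟩
  obtain ⟨Rk, hRk⟩ : ∃ Rk : (k : ℕ) → Site d (3 ^ k) → ℝ, ∀ k y'', Rk k y'' =
      ∑ y' : Site d (3 ^ k), Tinv k y' y'' * ψ k y' (siteOf d ((n + 1) * 3 ^ k) p) := ⟨_, fun _ _ => rfl⟩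
  obtain ⟨F, hF⟩ : ∃ F : ℕ → X d → ℝ, ∀ k b'', F k b'' =
      if windowMap d (3 ^ k) (siteOf d (3 ^ k) b'') = b'' then mk k (siteOf d (3 ^ k) b'') * Rk k (siteOf d (3 ^ k) b'') else 0 :=
    ⟨_, fun _ _ => rfl⟩
  -- the torus response part regrouped and read through the window
  have hgroup : ∀ k : ℕ, ∑ y' : Site d (3 ^ k), (∑ y'' : Site d (3 ^ k), Tinv k y' y'' * mk k y'') * ψ k y' (siteOf d ((n + 1) * 3 ^ k) p)
      = ∑' b'' : X d, F k b'' := by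
    intro k
    have e1 : ∑ y' : Site d (3 ^ k), (∑ y'' : Site d (3 ^ k), Tinv k y' y'' * mk k y'') * ψ k y' (siteOf d ((n + 1) * 3 ^ k) p)
        = ∑ y'' : Site d (3 ^ k), mk k y'' * Rk k y'' := by
      simp only [hRk, Finset.sum_mul, Finset.mul_sum]
      rw [Finset.sum_comm]
      exact Finset.sum_congr rfl fun y'' _ => Finset.sum_congr rfl fun y' _ => by ring
    rw [e1]
    have hWrep : ∀ b'' ∈ (Finset.univ : Finset (Site d (3 ^ k))).image (windowMap d (3 ^ k)),
        windowMap d (3 ^ k) (siteOf d (3 ^ k) b'') = b'' := fun b'' hb'' => by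
      obtain ⟨y, -, hy⟩ := Finset.mem_image.1 hb''; rw [← hy, siteOf_windowMap]
    have hF0 : ∀ b'', b'' ∉ (Finset.univ : Finset (Site d (3 ^ k))).image (windowMap d (3 ^ k)) → F k b'' = 0 := fun b'' hb'' => by
      rw [hF, if_neg]
      intro h
      exact hb'' (Finset.mem_image.2 ⟨siteOf d (3 ^ k) b'', Finset.mem_univ _, h⟩)
    rw [tsum_eq_sum (s := (Finset.univ : Finset (Site d (3 ^ k))).image (windowMap d (3 ^ k))) (fun b'' hb'' => hF0 b'' hb''),
      ← sum_window_reading (3 ^ k) _ hWrep (F k) hF0]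
    refine Finset.sum_congr rfl fun y'' _ => ?_
    rw [hF, if_pos (by rw [siteOf_windowMap]), siteOf_windowMap]
  -- the torus solutions are uniformly bounded ((167)); `u_k(σ q) → u(q)` ((247))
  have huB' : ∀ k x, |useq k x| ≤ Csup * Mf := fun k x =>
    H167 n (3 ^ k) (fun x => V (windowMap d ((n + 1) * 3 ^ k) x)) (fun x => hV _) (fun x => hV' _)
      (fun x z => K (windowMap d ((n + 1) * 3 ^ k) x) (windowMap d ((n + 1) * 3 ^ k) z)) (hKt₁ k) Mf (useq k)
      (fun x => f (windowMap d ((n + 1) * 3 ^ k) x)) (fun x => hfM _) (husol k) x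
  have hulim : ∀ q : X d, Tendsto (fun k => useq k (siteOf d ((n + 1) * 3 ^ k) q)) atTop (𝓝 (u q)) := by
    intro q
    obtain ⟨k₁, hk₁⟩ : ∃ k₁ : ℕ, k₁ = 2 * ∑ i, (blk n q i).natAbs + 1 := ⟨_, rfl⟩
    have hwin : ∀ k, k₁ ≤ k → windowMap d (3 ^ k) (siteOf d (3 ^ k) (blk n q)) = blk n q := fun k hk =>
      windowMap_siteOf d (3 ^ k) fun i => by
        have h := inWindow_of_le 0 k (blk n q) (by omega) i
        simpa using h
    obtain ⟨Cb, hCb⟩ : ∃ Cb : ℝ, Cb = ((2 * (CP' * (2 * (1 - exp (-(δ₀' - μ)))⁻¹) ^ d) * (2 * (1 - exp (-(μ / 2)))⁻¹) ^ d)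
          * (ε * (2 * (1 - exp (-(γ / 2)))⁻¹) ^ d * exp (γ / 2 * d) * Cu)
        + (2 * (CP' * (2 * (1 - exp (-(δ₀' - μ)))⁻¹) ^ d) * (2 * (1 - exp (-(μ / 2)))⁻¹) ^ d)
          * ((2 + 2 * (|lam| + Lam) * (2 * (CP' * (2 * (1 - exp (-(δ₀' - μ)))⁻¹) ^ d) * (2 * (1 - exp (-(μ / 2)))⁻¹) ^ d))
            * (Mf + 2 * (ε * (2 * (1 - exp (-γ))⁻¹) ^ d) * (Csup * Mf + Cu)))) := ⟨_, rfl⟩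
    have hcol : ∀ k, k₁ ≤ k → |useq k (siteOf d ((n + 1) * 3 ^ k) q) - u q|
        ≤ Cb * exp (-(μ / 2 / 2 * ((1 / 2) * ((3 ^ k : ℕ) : ℝ) - (2 + ∑ i, (((blk n q i).natAbs : ℕ) : ℝ))))) := by
      intro k hk
      have h := H247 n k V hV hV' ε γ μ hε hμ hμδ₀' hμγ hs1b hs2b K hK f Mf hfM (useq k) (Csup * Mf) (huB' k) (husol k) u Cu huB hu
        (siteOf d (3 ^ k) (blk n q)) q (by rw [hwin k hk]; exact mem_B.2 rfl)
      rw [← hCb] at h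
      refine h.trans (mul_le_mul_of_nonneg_left (exp_le_exp.2 ?_) ?_)
      · have e1 := le_max_right 0 ((((3 ^ k : ℕ) : ℝ) / 2 - 2
          - ∑ i, (((((siteOf d (3 ^ k) (blk n q)) i).valMinAbs).natAbs : ℕ) : ℝ)) / 2)
        have e2 := torusNorm_le_l1 (d := d) (3 ^ k) (blk n q)
        nlinarith
      · have := (abs_nonneg _).trans h
        rcases (mul_nonneg_iff_of_pos_right (exp_pos _)).1 this with h'; exact h'
    exact tendsto_of_exp_close (by linarith) (by norm_num) k₁ hcol
  -- termwise convergence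
  have hlim : ∀ b'' : X d, Tendsto (fun k => F k b'') atTop
      (𝓝 (((((n : ℝ) + 1) ^ d)⁻¹ * ∑ q ∈ B n b'', u q) * ∑' b' : X d, N b' b'' * ΨK b' p)) := by
    intro b''
    obtain ⟨k₁, hk₁⟩ : ∃ k₁ : ℕ, k₁ = 2 * ∑ i, (b'' i).natAbs + 2 := ⟨_, rfl⟩
    have hwin : ∀ k, k₁ ≤ k → windowMap d (3 ^ k) (siteOf d (3 ^ k) b'') = b'' := fun k hk =>
      windowMap_siteOf d (3 ^ k) fun i => by
        have h := inWindow_of_le 0 k b'' (by omega) i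
        simpa using h
    have h1 : Tendsto (fun k => mk k (siteOf d (3 ^ k) b'')) atTop (𝓝 ((((n : ℝ) + 1) ^ d)⁻¹ * ∑ q ∈ B n b'', u q)) := by
      have h := (tendsto_finsetSum (B n b'') fun q _ => hulim q).const_mul ((((n : ℝ) + 1) ^ d)⁻¹)
      refine h.congr' (Filter.eventually_atTop.2 ⟨k₁, fun k hk => ?_⟩)
      beta_reduce
      rw [hmk, hwin k hk, sum_B b'' (fun q => useq k (siteOf d ((n + 1) * 3 ^ k) q))]
    have h2 : Tendsto (fun k => Rk k (siteOf d (3 ^ k) b'')) atTop (𝓝 (∑' b' : X d, N b' b'' * ΨK b' p)) := by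
      have h := H244 ε μ hε hεε₀ hμ hμδ₀ hμγ hs1a hs2a hεs γz Cz CΨ CN ν hγz hCz hCΨ hCN hν n V hV hV' K hK hKs ΨK N hA3 hA4 hD1 hE1 hE0
        hC1 hC2 ψ hψ b'' p
      refine h.congr fun k => ?_
      rw [hRk]; exact Finset.sum_congr rfl fun y' _ => by rw [hTinv]
    refine (h1.mul h2).congr' (Filter.eventually_atTop.2 ⟨k₁, fun k hk => ?_⟩)
    beta_reduce; rw [hF, if_pos (hwin k hk)]
  -- uniform bounds
  have hψB : ∀ k y' x, |ψ k y' x| ≤ Csup * 1 := fun k y' x =>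
    H167 n (3 ^ k) (fun x => V (windowMap d ((n + 1) * 3 ^ k) x)) (fun x => hV _) (fun x => hV' _)
      (fun x z => K (windowMap d ((n + 1) * 3 ^ k) x) (windowMap d ((n + 1) * 3 ^ k) z)) (hKt₁ k) 1 (ψ k y')
      (fun x => if siteOf d (3 ^ k) (blk n (windowMap d ((n + 1) * 3 ^ k) x)) = y' then (1 : ℝ) else 0)
      (fun x => by split_ifs <;> simp) (hψ k y') x
  have hTB : ∀ k (y y' : Site d (3 ^ k)), |Tinv k y y'| ≤ ct * exp (-(δt * ∑ i, (((y i - y' i).valMinAbs.natAbs : ℕ) : ℝ))) :=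
    fun k y y' => by
      rw [hTinv]
      exact H166 n (3 ^ k) (fun x => V (windowMap d ((n + 1) * 3 ^ k) x)) (fun x => hV _) (fun x => hV' _)
        (fun x z => K (windowMap d ((n + 1) * 3 ^ k) x) (windowMap d ((n + 1) * 3 ^ k) z)) (hKts k) (hKt k) (ψ k) (hψ k) y y'
  have hfprof : ∀ (k : ℕ) (x : Site d ((n + 1) * 3 ^ k)), |f (windowMap d ((n + 1) * 3 ^ k) x)| ≤ Mf * exp (-(1
      * ∑ i, ((((siteOf d (3 ^ k) (blk n (windowMap d ((n + 1) * 3 ^ k) x))) i - (siteOf d (3 ^ k) b₀) i).valMinAbs.natAbs : ℕ) : ℝ))) := by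
    intro k x
    by_cases hb : blk n (windowMap d ((n + 1) * 3 ^ k) x) = b₀
    · rw [hb, (isPseudoDist_torus (d := d) (3 ^ k)).zero, mul_zero, neg_zero, exp_zero, mul_one]; exact hfM _
    · rw [hf0 _ hb, abs_zero]; positivity
  have hmkB : ∀ k y'', |mk k y''| ≤ Cp * Mf * exp (-(δp * ∑ i, (((y'' i - (siteOf d (3 ^ k) b₀) i).valMinAbs.natAbs : ℕ) : ℝ))) := by
    intro k y''
    rw [hmk]
    exact blockMeans_decay n k (useq k) (siteOf d (3 ^ k) b₀) (fun x => H173 n (3 ^ k) (fun x => V (windowMap d ((n + 1) * 3 ^ k) x))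
      (fun x => hV _) (fun x => hV' _) (fun x z => K (windowMap d ((n + 1) * 3 ^ k) x) (windowMap d ((n + 1) * 3 ^ k) z)) (hKt k)
      (siteOf d (3 ^ k) b₀) Mf (useq k) (fun x => f (windowMap d ((n + 1) * 3 ^ k) x)) (hfprof k) (husol k) x) y''
  have hRkB : ∀ k y'', |Rk k y''| ≤ ct * (Csup * 1) * (2 * (1 - exp (-δt))⁻¹) ^ d := fun k y'' => by
    rw [hRk]; exact response_bounded n k hct.le hδt (by positivity) (Tinv k) (ψ k) (hTB k) (hψB k) y'' _
  -- summable domination, uniform in `k`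
  have hKt0 : 0 < (2 * (1 - exp (-δt))⁻¹) ^ d := K_pos (d := d) hδt
  have hdom : ∀ k b'', ‖F k b''‖ ≤ Cp * Mf * exp (δp * ∑ i, (((b₀ i).natAbs : ℕ) : ℝ)) * (ct * (Csup * 1) * (2 * (1 - exp (-δt))⁻¹) ^ d)
      * exp (-(δp * ∑ i, ((((0 : X d) i - b'' i).natAbs : ℕ) : ℝ))) := fun k b'' => by
    rw [hF]
    exact window_term_dominated' k (by positivity) hδp.le (by positivity) (mk k) (Rk k) b₀ (hmkB k) (hRkB k) b''
  have hbsum : Summable fun b'' : X d => Cp * Mf * exp (δp * ∑ i, (((b₀ i).natAbs : ℕ) : ℝ))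
      * (ct * (Csup * 1) * (2 * (1 - exp (-δt))⁻¹) ^ d) * exp (-(δp * ∑ i, ((((0 : X d) i - b'' i).natAbs : ℕ) : ℝ))) :=
    (summable_exp_l1 hδp 0).mul_left _
  have hT := tendsto_tsum_of_dominated_convergence hbsum hlim (Eventually.of_forall hdom)
  refine ((hulim p).sub hT).congr fun k => ?_
  rw [← hgroup k]
  simp only [hTinv, hmk]

/-! ## §3. Toy -/

/-- Toy (`d = 3`, `a = 1`, `λ = 0`, `Λ = 1`, `γ = 2`): the four tree constants exist. -/
example : ∃ C₀ CP δ₀ ε₀ : ℝ, 0 < C₀ ∧ 0 < CP ∧ 0 < δ₀ ∧ 0 < ε₀ :=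
  let ⟨C₀, CP, δ₀, ε₀, h1, h2, h3, h4, _⟩ := zd_perturbed_fluctuation_torus_limit (d := 3) le_rfl 1 one_pos (lam := 0) (Lam := 1)
    (γ := 2) (by rw [min_eq_right (by norm_num : (1 : ℝ) ≤ 2)]; norm_num) zero_le_one (by norm_num)
  ⟨C₀, CP, δ₀, ε₀, h1, h2, h3, h4⟩

end Summit.QuantumFields.BalabanUV.T4Continuum.NE7b.SupZdPerturbedCovarianceTorusLimit
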